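import Literature.AlgebraicGeometry.Motives.AbelianVarietyLatticeTensor
import HarnessLib

/-!
# `Hom`-characters and `Hom`-counts of `Y ⊗_ℤ M`: `χ_B(ρ(g)) = tr m(g) · χ_B(β(g))`,
# `|G| · rk_ℤ Hom(B_W(Y ⊗ M), B) = (Σ_g c_W(g) tr m(g)) · rk_ℤ Hom(Y, B)` over any field, and over a perfect field
# `B_W(Y ⊗ M) ∼ Y^{d_W}`, `B_H(Y ⊗ M) ∼ Y^{rank M^H}`, `Y ⊗ M ∼ ∏_W Y^{d_W}`

Sequel of `Motives/AbelianVarietyLatticeTensor`: `X = Y ⊗_ℤ M` is the power `⊕_{i ∈ ι} Y e_i` (bicone `b`, `Σ_i π_i ≫ ι_i = 𝟙`) of an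
abelian variety `Y` over a field `K`, carrying the action `ρ` of `G` through an integral matrix representation `m : G → M_ι(ℤ)`
(a `ℤ[G]`-lattice `M`) and a twist `β : G → End Y`: **`ι_j ≫ ρ(g) ≫ π_i = m(g)_{ij} • β(g)`** (`hρ`; untwisted `hρ₁`: `• 𝟙_Y`).
The prequel computed the `ℓ`-adic character and the DIMENSIONS of the Kani–Rosen factors `B_H = Im N_H` and isotypical components
`B_W = Im u_W`; here the same is done for the `Hom`-SIDE CHARACTERS `χ_B(w) = tr_ℤ(w ∘ − | Hom(X, B))` of Kani–Rosen §2 (any field,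
no auxiliary prime), which over a PERFECT field determine the isogeny class (the tree's `isIsogenous_iff_forall_finrank_hom_eq'`):

* §1 **`χ_B(F) = tr(P) · χ_B(φ)`** for a scalar-block endomorphism `ι_j F π_i = P_{ij} • φ` of `Y^ι` (`trace_leftComp_eq_trace_mul_of_blocks`:
  `Hom(Y ⊗ M, B) = Hom(Y, B) ⊗ M^∨`), hence **`χ_B(ρ(g)) = tr m(g) · χ_B(β(g))`** and, untwisted, **`χ_B(ρ(g)) = tr m(g) · rk_ℤ Hom(Y, B)`**
  (MRS Prop. 1.6 (i) `Hom(I ⊗ V, W) ≅ Hom_𝒪(I, 𝒪) ⊗ Hom(V, W)`; Serre Prop. 2 (ii));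
* §2 `Hom`-COUNTS over ANY field (untwisted tensor): **`|H| · rk_ℤ Hom(B_H(Y ⊗ M), B) = (Σ_{h ∈ H} tr m(h)) · rk_ℤ Hom(Y, B)`** for every
  finite subgroup `H` and every `B` (`card_mul_finrank_hom_image_norm_eq`; `χ_B(N_H) = |H| rk Hom(Im N_H, B)` since `N_H² = |H| N_H`),
  **`|G| · rk_ℤ Hom(B_W(Y ⊗ M), B) = (Σ_g c_W(g) tr m(g)) · rk_ℤ Hom(Y, B)`** for every isotypical component (`card_mul_finrank_hom_isotypical_eq`;
  `u_W² = |G| u_W`), the forms `rk Hom(B_H, B) = d rk Hom(Y, B)`, `rk Hom(B_W, B) = d_W rk Hom(Y, B)` for `|H| d = Σ_h tr m(h)`,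
  `|G| d_W = Σ_g c_W(g) tr m(g)` (`d = rank M^H`, `d_W = dim_ℚ e_W M_ℚ`), and **`Σ_W d_W = |ι| = rank M`** when `Y ≠ 0`
  (`sum_eq_card`: `rk Hom(Y ⊗ M, Y) = |ι| rk End Y = Σ_W rk Hom(B_W, Y)`; "`Res V ∼ ⊕_ρ V_ρ`", `Σ_ρ rank I_ρ = rank I`);
* §3 over a PERFECT field: **`B_W(Y ⊗ M) ∼ Y^{d_W} = ⨁_{Fin d_W} Y`** (`isIsogenous_isotypical_biproduct`: the `ρ`-twist `V_ρ = I_ρ ⊗ V`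
  of MRS Def. 4.3 is `V^{rank I_ρ}` up to isogeny, as it must be over a field where `I_ρ` is untwisted), **`B_H(Y ⊗ M) ∼ Y^{rank M^H}`**,
  `B_G(Y ⊗ M) ∼ Y^{rank M^G}`, and THE ISOTYPICAL DECOMPOSITION **`Y ⊗ M ∼ ∏_{W ∈ Irr_ℚ(G)} Y^{d_W}`**
  (`isIsogenous_biproduct_biproduct`; MRS Thm. 4.5 `Res V ∼ ⊕_ρ V_ρ` / Cor. 2.5 with Lange–Rodríguez Thm. 2.9.1 (b)).

Everything is a theorem; `m`, `β`, `ρ`, `hρ`/`hρ₁`, the isotypical data `c`, `u` (`|G| e_W = Σ_g c_W(g) g`, `u_W = Σ_g c_W(g) ρ(g)`)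
and the norm maps `N` (`End.of N = Σ_h ρ(h)`) are hypotheses in the formats of the cited tree files.

## References

* [MazurRubinSilverberg2007] B. Mazur, K. Rubin, A. Silverberg, *Twisting commutative algebraic groups*, J. Algebra 314 (2007):
  Prop. 1.6 (i)–(ii) (`Hom_𝒪(I, J) ⊗ Hom(V, W) → Hom(I ⊗ V, J ⊗ W)`), Thm. 2.1 (i), (iii) (`I ⊗ V ≅ V^{rank I}` where `I` is
  untwisted), Lemma 2.4, Cor. 2.5 (`I ⊗ ℚ ≅ ⊕ J_i ⊗ ℚ ⇒ I ⊗ V ∼ ⊕ J_i ⊗ V`), Def. 4.3 (`V_ρ = I_ρ ⊗ V`), Thm. 4.5 (`Res V ∼ ⊕_ρ V_ρ`).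
  Held `paper:doi-10-1016-j-jalgebra-2007-02-052`, pp. 5–7, 10 read.
* [Milne1972ArithmeticAV] J. S. Milne, *On the arithmetic of abelian varieties*, Invent. Math. 17 (1972), §2 (the abelian variety
  `M ⊗ A`), as reported by [MazurRubinSilverberg2007].
* [KaniRosen1989] E. Kani, M. Rosen, *Idempotent relations and factors of Jacobians*, Math. Ann. 284 (1989), §2 (the characters
  `χ = tr(− | Hom(X, B) ⊗ ℚ)` of `End⁰ X`), §3 Thm. B.
* [LangeRodriguez2022] H. Lange, R. E. Rodríguez, *Decomposition of Jacobians by Prym Varieties*, LNM 2310 (2022), §2.9.1 Thm. 2.9.1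
  (b) and Prop. 2.9.3 (PDF pp. 43, 46).
* [SerreLinearRepresentations1977] J.-P. Serre, *Linear Representations of Finite Groups*, GTM 42, §2.1 Prop. 2 (ii), §2.3 (Thm. 4
  Cor., Ex. 2.6 (a)), §2.6 Thm. 8.  Held, PDF pp. 15, 19–20, 25 read.
* [LangeRecillas2004] H. Lange, S. Recillas, *Abelian varieties with group action*, J. reine angew. Math. 575 (2004), §1 Prop. 1.1
  (`B_W ∼ B^{n_W}`).
* [Milne1986AbelianVarieties] J. S. Milne, *Abelian varieties*, in Cornell–Silverman (1986), §12 p. 122 (multiplicities up to isogeny).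
* [MumfordAV1970] D. Mumford, *Abelian Varieties* (1970), §19 Thm. 3 (p. 176: `Hom(X, Y)` is free of finite rank).
-/

noncomputable section

open CategoryTheory CategoryTheory.Limits
open Literature.NumberTheory.DiophantineGeometry
open Literature.RepresentationTheory.FiniteGroups

universe u

namespace Literature.AlgebraicGeometry.Motives

namespace AbelianVariety

namespace LatticeTensor

variable {K : Type u} [Field K]

/-! ## §1 `Hom`-side characters: `χ_B(F) = tr(P) · χ_B(φ)` and `χ_B(ρ(g)) = tr m(g) · χ_B(β(g))` -/

section Character

variable {Y : AbelianVariety K} (B : AbelianVariety K) {ι : Type} [Fintype ι] [DecidableEq ι] (b : Bicone (fun _ : ι ↦ Y))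
  {G : Type} [Group G] (m : G →* Matrix ι ι ℤ) (β : G →* End Y) (ρ : G →* End b.pt)

omit [Fintype ι] [DecidableEq ι] in
/-- `χ_B(n • φ) = n · χ_B(φ)`: `tr_ℤ((n • φ) ∘ − | Hom(Y, B)) = n · tr_ℤ(φ ∘ − | Hom(Y, B))` (`(n • φ) ≫ f = n • (φ ≫ f)`).
[cite: KaniRosen1989, §2 (the characters `χ` are additive)] [cite: MumfordAV1970, §19 Thm. 3 (p. 176)] -/
theorem trace_leftComp_zsmul (n : ℤ) (φ : Y ⟶ Y) :
    LinearMap.trace ℤ (Y ⟶ B) (Preadditive.leftComp B (n • φ)).toIntLinearMap =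
      n * LinearMap.trace ℤ (Y ⟶ B) (Preadditive.leftComp B φ).toIntLinearMap := by
  have h : (Preadditive.leftComp B (n • φ)).toIntLinearMap = n • (Preadditive.leftComp B φ).toIntLinearMap := by
    refine LinearMap.ext fun f ↦ ?_
    change (n • φ) ≫ f = n • (φ ≫ f)
    rw [Preadditive.zsmul_comp]
  rw [h, map_zsmul, zsmul_eq_mul, Int.cast_id]

omit [Fintype ι] [DecidableEq ι] in
/-- `χ_B(𝟙_Y) = rk_ℤ Hom(Y, B)` (`Hom(Y, B)` is free of finite rank). [cite: MumfordAV1970, §19 Thm. 3 (p. 176)] [cite: KaniRosen1989, §2] -/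
theorem trace_leftComp_id : LinearMap.trace ℤ (Y ⟶ B) (Preadditive.leftComp B (𝟙 Y)).toIntLinearMap = Module.finrank ℤ (Y ⟶ B) := by
  haveI : Module.Free ℤ (Y ⟶ B) := module_free_hom_holds Y B
  haveI : Module.Finite ℤ (Y ⟶ B) := module_finite_hom_holds Y B
  rw [show (Preadditive.leftComp B (𝟙 Y)).toIntLinearMap = LinearMap.id from LinearMap.ext fun f ↦ Category.id_comp f,
    LinearMap.trace_id]

omit [DecidableEq ι] in
/-- **`χ_B(F) = tr(P) · χ_B(φ)` for an endomorphism of `Y^ι` with scalar blocks `ι_j ≫ F ≫ π_i = P_{ij} • φ`** (any field, every `B`):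
`χ_B(F) = Σ_i χ_B(ι_i F π_i)` (the tree's `trace_leftComp_permPower_eq_sum`) and `χ_B(P_{ii} • φ) = P_{ii} χ_B(φ)` — the character of
`Hom(Y ⊗ M, B) = Hom(Y, B) ⊗ M^∨` as a tensor product. [cite: MazurRubinSilverberg2007, Prop. 1.6 (i)] [cite: KaniRosen1989, §2]
[cite: SerreLinearRepresentations1977, §2.1 Prop. 2 (ii)] -/
theorem trace_leftComp_eq_trace_mul_of_blocks (hb : ∑ j, b.π j ≫ b.ι j = 𝟙 b.pt) {F : b.pt ⟶ b.pt} {P : Matrix ι ι ℤ}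
    {φ : Y ⟶ Y} (hF : ∀ i j : ι, b.ι j ≫ F ≫ b.π i = P i j • φ) :
    LinearMap.trace ℤ (b.pt ⟶ B) (Preadditive.leftComp B F).toIntLinearMap =
      P.trace * LinearMap.trace ℤ (Y ⟶ B) (Preadditive.leftComp B φ).toIntLinearMap := by
  rw [trace_leftComp_permPower_eq_sum B b hb F, Matrix.trace, Finset.sum_mul]
  refine Finset.sum_congr rfl fun i _ ↦ ?_
  rw [hF i i, trace_leftComp_zsmul, Matrix.diag_apply]

/-- **`χ_B(ρ(g)) = tr m(g) · χ_B(β(g))` on `Y ⊗ M`** (any field, every `B`): the `Hom`-side character of the tensor product is the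
product. [cite: MazurRubinSilverberg2007, Prop. 1.6 (i)] [cite: KaniRosen1989, §2] [cite: SerreLinearRepresentations1977, §2.1 Prop. 2 (ii)] -/
theorem trace_leftComp_asHom_eq_trace_mul (hb : ∑ j, b.π j ≫ b.ι j = 𝟙 b.pt)
    (hρ : ∀ (g : G) (i j : ι), b.ι j ≫ End.asHom (ρ g) ≫ b.π i = m g i j • End.asHom (β g)) (g : G) :
    LinearMap.trace ℤ (b.pt ⟶ B) (Preadditive.leftComp B (End.asHom (ρ g))).toIntLinearMap =
      (m g).trace * LinearMap.trace ℤ (Y ⟶ B) (Preadditive.leftComp B (End.asHom (β g))).toIntLinearMap :=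
  trace_leftComp_eq_trace_mul_of_blocks B b hb (hρ g)

/-- **`χ_B(ρ(g)) = tr m(g) · rk_ℤ Hom(Y, B)` for the untwisted tensor** `ι_j ρ(g) π_i = m(g)_{ij} • 𝟙_Y` (any field, every `B`).
[cite: MazurRubinSilverberg2007, Prop. 1.6 (i) and Thm. 2.1 (i)] [cite: KaniRosen1989, §2] [cite: SerreLinearRepresentations1977, §2.1 Prop. 1 (i) and Prop. 2 (ii)] -/
theorem trace_leftComp_asHom_eq_trace_mul_finrank (hb : ∑ j, b.π j ≫ b.ι j = 𝟙 b.pt)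
    (hρ₁ : ∀ (g : G) (i j : ι), b.ι j ≫ End.asHom (ρ g) ≫ b.π i = m g i j • 𝟙 Y) (g : G) :
    LinearMap.trace ℤ (b.pt ⟶ B) (Preadditive.leftComp B (End.asHom (ρ g))).toIntLinearMap =
      (m g).trace * Module.finrank ℤ (Y ⟶ B) := by
  rw [trace_leftComp_eq_trace_mul_of_blocks B b hb (hρ₁ g), trace_leftComp_id]

end Character

/-! ## §2 `Hom`-counts over any field: `|H| · rk Hom(B_H(Y ⊗ M), B) = (Σ_h tr m(h)) · rk Hom(Y, B)` and the isotypical analogue -/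

section HomCounts

variable {Y : AbelianVariety K} (B : AbelianVariety K) {ι : Type} [Fintype ι] [DecidableEq ι] (b : Bicone (fun _ : ι ↦ Y))
  {G : Type} [Group G] (m : G →* Matrix ι ι ℤ) (ρ : G →* End b.pt)

/-- **`|H| · rk_ℤ Hom(B_H(Y ⊗ M), B) = (Σ_{h ∈ H} tr m(h)) · rk_ℤ Hom(Y, B)` for every abelian variety `B`** (any field; `H` a finite
subgroup, `N_H = Σ_{h ∈ H} ρ(h)`, `B_H = Im N_H`, untwisted tensor): `|H| · rk Hom(Im N_H, B) = χ_B(N_H) = Σ_h χ_B(ρ(h)) = Σ_h tr m(h) · rk Hom(Y, B)`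
(`N_H² = |H| N_H` and the tree's `trace_leftComp_eq_mul_finrank`).  So `B_H(Y ⊗ M)` and `Y^{rank M^H}` have the same `Hom`-counts.
[cite: KaniRosen1989, §2 and §3 Thm. B] [cite: SerreLinearRepresentations1977, §2.3 Thm. 4 Cor. and Ex. 2.6 (a)]
[cite: MazurRubinSilverberg2007, Thm. 2.1 (i)] [cite: Milne1986AbelianVarieties, §12 p. 122] -/
theorem card_mul_finrank_hom_image_norm_eq {H : Subgroup G} [Fintype H] (hb : ∑ j, b.π j ≫ b.ι j = 𝟙 b.pt)
    (hρ₁ : ∀ (g : G) (i j : ι), b.ι j ≫ End.asHom (ρ g) ≫ b.π i = m g i j • 𝟙 Y)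
    {N : b.pt ⟶ b.pt} (hN : End.of N = ∑ h : H, ρ h) :
    (Fintype.card H : ℤ) * Module.finrank ℤ (image N ⟶ B) = (∑ h : H, (m h).trace) * Module.finrank ℤ (Y ⟶ B) := by
  have hχ := trace_leftComp_eq_mul_finrank B (norm_comp_norm_eq_card_nsmul ρ hN)
  have hN' : N = ∑ h : H, (1 : ℤ) • End.asHom (ρ h) := by
    rw [Finset.sum_congr rfl fun (h : H) _ ↦ one_zsmul (End.asHom (ρ (h : G)))]
    exact hN
  rw [← hχ, hN', trace_leftComp_sum_zsmul, Finset.sum_mul]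
  refine Finset.sum_congr rfl fun h _ ↦ ?_
  rw [one_mul, trace_leftComp_asHom_eq_trace_mul_finrank B b m ρ hb hρ₁ (h : G)]

/-- **`rk_ℤ Hom(B_H(Y ⊗ M), B) = d · rk_ℤ Hom(Y, B)` whenever `|H| · d = Σ_{h ∈ H} tr m(h)`** (`d = rank M^H`; any field, every `B`).
[cite: KaniRosen1989, §3 Thm. B] [cite: SerreLinearRepresentations1977, §2.3 Thm. 4 Cor. and Ex. 2.6 (a)] [cite: MazurRubinSilverberg2007, Thm. 2.1 (i)] -/
theorem finrank_hom_image_norm_eq_of_card_mul_eq {H : Subgroup G} [Fintype H] (hb : ∑ j, b.π j ≫ b.ι j = 𝟙 b.pt)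
    (hρ₁ : ∀ (g : G) (i j : ι), b.ι j ≫ End.asHom (ρ g) ≫ b.π i = m g i j • 𝟙 Y)
    {N : b.pt ⟶ b.pt} (hN : End.of N = ∑ h : H, ρ h) {d : ℕ} (hd : (Fintype.card H : ℤ) * d = ∑ h : H, (m h).trace) :
    Module.finrank ℤ (image N ⟶ B) = d * Module.finrank ℤ (Y ⟶ B) := by
  have h := card_mul_finrank_hom_image_norm_eq B b m ρ hb hρ₁ hN
  rw [← hd, mul_assoc] at h
  exact_mod_cast mul_left_cancel₀ (Nat.cast_ne_zero.2 Fintype.card_ne_zero : (Fintype.card H : ℤ) ≠ 0) h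

/-- **`|G| · rk_ℤ Hom(B_G(Y ⊗ M), B) = (Σ_{g ∈ G} tr m(g)) · rk_ℤ Hom(Y, B)`**, the whole-group form (`G` finite, `B_G = Im Σ_g ρ(g)`,
any field, every `B`). [cite: KaniRosen1989, §2 and §3 Thm. B] [cite: SerreLinearRepresentations1977, §2.3 Thm. 4 Cor. and Ex. 2.6 (a)]
[cite: MazurRubinSilverberg2007, Thm. 2.1 (i)] -/
theorem card_mul_finrank_hom_image_normG_eq [Fintype G] (hb : ∑ j, b.π j ≫ b.ι j = 𝟙 b.pt)
    (hρ₁ : ∀ (g : G) (i j : ι), b.ι j ≫ End.asHom (ρ g) ≫ b.π i = m g i j • 𝟙 Y)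
    {NG : b.pt ⟶ b.pt} (hNG : End.of NG = ∑ g, ρ g) :
    (Fintype.card G : ℤ) * Module.finrank ℤ (image NG ⟶ B) = (∑ g, (m g).trace) * Module.finrank ℤ (Y ⟶ B) := by
  have hχ := trace_leftComp_eq_mul_finrank B (normG_comp_normG_eq_card_nsmul ρ hNG)
  have hNG' : NG = ∑ g, (1 : ℤ) • End.asHom (ρ g) := by
    rw [Finset.sum_congr rfl fun g _ ↦ one_zsmul (End.asHom (ρ g))]
    exact hNG
  rw [← hχ, hNG', trace_leftComp_sum_zsmul, Finset.sum_mul]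
  refine Finset.sum_congr rfl fun g _ ↦ ?_
  rw [one_mul, trace_leftComp_asHom_eq_trace_mul_finrank B b m ρ hb hρ₁ g]

/-- **`rk_ℤ Hom(B_G(Y ⊗ M), B) = d · rk_ℤ Hom(Y, B)` whenever `|G| · d = Σ_g tr m(g)`** (`d = rank M^G`; any field, every `B`).
[cite: KaniRosen1989, §3 Thm. B] [cite: SerreLinearRepresentations1977, §2.3 Thm. 4 Cor. and Ex. 2.6 (a)] -/
theorem finrank_hom_image_normG_eq_of_card_mul_eq [Fintype G] (hb : ∑ j, b.π j ≫ b.ι j = 𝟙 b.pt)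
    (hρ₁ : ∀ (g : G) (i j : ι), b.ι j ≫ End.asHom (ρ g) ≫ b.π i = m g i j • 𝟙 Y)
    {NG : b.pt ⟶ b.pt} (hNG : End.of NG = ∑ g, ρ g) {d : ℕ} (hd : (Fintype.card G : ℤ) * d = ∑ g, (m g).trace) :
    Module.finrank ℤ (image NG ⟶ B) = d * Module.finrank ℤ (Y ⟶ B) := by
  have h := card_mul_finrank_hom_image_normG_eq B b m ρ hb hρ₁ hNG
  rw [← hd, mul_assoc] at h
  exact_mod_cast mul_left_cancel₀ (Nat.cast_ne_zero.2 Fintype.card_ne_zero : (Fintype.card G : ℤ) ≠ 0) h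

variable [Fintype G] {c : ratCharIdempotents G → G → ℤ}
  (hc : ∀ e : ratCharIdempotents G,
    (Fintype.card G : ℚ) • (e : MonoidAlgebra ℚ G) = ∑ g, (c e g : ℚ) • MonoidAlgebra.of ℚ G g)
  {u : ratCharIdempotents G → (b.pt ⟶ b.pt)} (hu : ∀ e, End.of (u e) = ∑ g, c e g • ρ g)

include hu in
/-- **`χ_B(u_W) = (Σ_g c_W(g) tr m(g)) · rk_ℤ Hom(Y, B)`** for the integral lift `u_W = Σ_g c_W(g) ρ(g)` of `|G| e_W` on the untwisted tensor
`Y ⊗ M` (linearity of `χ_B` and §1). [cite: KaniRosen1989, §2] [cite: SerreLinearRepresentations1977, §2.6 Thm. 8 (ii)] -/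
theorem trace_leftComp_isotypical_eq (hb : ∑ j, b.π j ≫ b.ι j = 𝟙 b.pt)
    (hρ₁ : ∀ (g : G) (i j : ι), b.ι j ≫ End.asHom (ρ g) ≫ b.π i = m g i j • 𝟙 Y) (e : ratCharIdempotents G) :
    LinearMap.trace ℤ (b.pt ⟶ B) (Preadditive.leftComp B (u e)).toIntLinearMap =
      (∑ g, c e g * (m g).trace) * Module.finrank ℤ (Y ⟶ B) := by
  rw [isotypical_eq_sum_zsmul_asHom ρ hu e, trace_leftComp_sum_zsmul, Finset.sum_mul]
  refine Finset.sum_congr rfl fun g _ ↦ ?_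
  rw [trace_leftComp_asHom_eq_trace_mul_finrank B b m ρ hb hρ₁ g, mul_assoc]

include hc hu

/-- **`|G| · rk_ℤ Hom(B_W(Y ⊗ M), B) = (Σ_g c_W(g) tr m(g)) · rk_ℤ Hom(Y, B)` for every abelian variety `B`** (any field; `B_W = Im u_W`
the isotypical component of the untwisted tensor): `|G| · rk Hom(Im u_W, B) = χ_B(u_W)` because `u_W² = |G| u_W`.  So `B_W(Y ⊗ M)`
and `Y^{d_W}`, `|G| d_W = Σ_g c_W(g) tr m(g) = |G| dim_ℚ(e_W M_ℚ)`, have the same `Hom`-counts.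
[cite: LangeRodriguez2022, §2.9.1 Thm. 2.9.1 and Prop. 2.9.3 (PDF pp. 43, 46)] [cite: KaniRosen1989, §2]
[cite: MazurRubinSilverberg2007, Def. 4.3 and Thm. 4.5] [cite: SerreLinearRepresentations1977, §2.6 Thm. 8 (ii)] -/
theorem card_mul_finrank_hom_isotypical_eq (hb : ∑ j, b.π j ≫ b.ι j = 𝟙 b.pt)
    (hρ₁ : ∀ (g : G) (i j : ι), b.ι j ≫ End.asHom (ρ g) ≫ b.π i = m g i j • 𝟙 Y) (e : ratCharIdempotents G) :
    (Fintype.card G : ℤ) * Module.finrank ℤ (image (u e) ⟶ B) = (∑ g, c e g * (m g).trace) * Module.finrank ℤ (Y ⟶ B) := by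
  rw [← trace_leftComp_isotypical_eq B b m ρ hu hb hρ₁ e]
  exact (trace_leftComp_eq_mul_finrank B (comp_self_eq_card_nsmul_isotypical ρ hc hu e)).symm

/-- **`rk_ℤ Hom(B_W(Y ⊗ M), B) = d · rk_ℤ Hom(Y, B)` whenever `|G| · d = Σ_g c_W(g) tr m(g)`** (`d = dim_ℚ e_W M_ℚ`; any field, every `B`).
[cite: LangeRodriguez2022, §2.9.1 Prop. 2.9.3 (PDF p. 46)] [cite: MazurRubinSilverberg2007, Def. 4.3, Thm. 4.5 and Thm. 2.1 (i)] -/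
theorem finrank_hom_isotypical_eq_of_card_mul_eq (hb : ∑ j, b.π j ≫ b.ι j = 𝟙 b.pt)
    (hρ₁ : ∀ (g : G) (i j : ι), b.ι j ≫ End.asHom (ρ g) ≫ b.π i = m g i j • 𝟙 Y) (e : ratCharIdempotents G) {d : ℕ}
    (hd : (Fintype.card G : ℤ) * d = ∑ g, c e g * (m g).trace) :
    Module.finrank ℤ (image (u e) ⟶ B) = d * Module.finrank ℤ (Y ⟶ B) := by
  have h := card_mul_finrank_hom_isotypical_eq B b m ρ hc hu hb hρ₁ e
  rw [← hd, mul_assoc] at h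
  exact_mod_cast mul_left_cancel₀ (Nat.cast_ne_zero.2 Fintype.card_ne_zero : (Fintype.card G : ℤ) ≠ 0) h

/-- **`Σ_W d_W = |ι| = rank M` for `Y ≠ 0`** (any field): on `Hom`-counts into `Y`, `|ι| · rk End Y = rk Hom(Y ⊗ M, Y) = Σ_W rk Hom(B_W, Y)
= (Σ_W d_W) · rk End Y` (the tree's `finrank_hom_eq_sum_finrank_hom_isotypical`) and `rk End Y > 0` — the ranks of the isotypical pieces
`M ∩ e_W M_ℚ` of the lattice add up to `rank M`. [cite: MazurRubinSilverberg2007, Thm. 4.5 and Cor. 2.5 (`I ⊗ ℚ ≅ ⊕ J_i ⊗ ℚ`)]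
[cite: LangeRodriguez2022, §2.9.1 Thm. 2.9.1 (b) (PDF p. 43)] [cite: SerreLinearRepresentations1977, §2.6 Thm. 8] -/
theorem sum_eq_card (hY : 0 < Y.dim) (hb : ∑ j, b.π j ≫ b.ι j = 𝟙 b.pt)
    (hρ₁ : ∀ (g : G) (i j : ι), b.ι j ≫ End.asHom (ρ g) ≫ b.π i = m g i j • 𝟙 Y) {d : ratCharIdempotents G → ℕ}
    (hd : ∀ e, (Fintype.card G : ℤ) * d e = ∑ g, c e g * (m g).trace) :
    ∑ e, d e = Fintype.card ι := by
  have h : Fintype.card ι * Module.finrank ℤ (Y ⟶ Y) = (∑ e, d e) * Module.finrank ℤ (Y ⟶ Y) := by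
    rw [← finrank_hom_permPower_eq Y b hb, finrank_hom_eq_sum_finrank_hom_isotypical ρ hc hu Y, Finset.sum_mul]
    exact Finset.sum_congr rfl fun e _ ↦ finrank_hom_isotypical_eq_of_card_mul_eq Y b m ρ hc hu hb hρ₁ e (hd e)
  exact (Nat.eq_of_mul_eq_mul_right (finrank_end_pos hY) h).symm

end HomCounts

/-! ## §3 Over a perfect field: `B_W(Y ⊗ M) ∼ Y^{d_W}`, `B_H(Y ⊗ M) ∼ Y^{rank M^H}`, `Y ⊗ M ∼ ∏_W Y^{d_W}` -/

section Isogeny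

variable [PerfectField K] {Y : AbelianVariety K} {ι : Type} [Fintype ι] [DecidableEq ι] (b : Bicone (fun _ : ι ↦ Y))
  {G : Type} [Group G] (m : G →* Matrix ι ι ℤ) (ρ : G →* End b.pt)

/-- **`B_H(Y ⊗ M) ∼ Y^d = ⨁_{Fin d} Y` whenever `|H| · d = Σ_{h ∈ H} tr m(h)`** (`d = rank M^H`; perfect field, `H` a finite subgroup,
`B_H = Im Σ_{h ∈ H} ρ(h)`): equal `Hom`-counts into every `B` (§2) and the tree's criterion `isIsogenous_iff_forall_finrank_hom_eq'` —
the fixed part of `Y ⊗ M` is `Y ⊗ M^H` up to isogeny. [cite: KaniRosen1989, §3 Thm. B] [cite: MazurRubinSilverberg2007, Thm. 2.1 (i), (iii) and Lemma 2.4]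
[cite: Milne1986AbelianVarieties, §12 p. 122] [cite: LangeRodriguez2022, §2.9.1 Prop. 2.9.3 (PDF p. 46)] -/
theorem isIsogenous_image_norm_biproduct {H : Subgroup G} [Fintype H] (hb : ∑ j, b.π j ≫ b.ι j = 𝟙 b.pt)
    (hρ₁ : ∀ (g : G) (i j : ι), b.ι j ≫ End.asHom (ρ g) ≫ b.π i = m g i j • 𝟙 Y)
    {N : b.pt ⟶ b.pt} (hN : End.of N = ∑ h : H, ρ h) {d : ℕ} (hd : (Fintype.card H : ℤ) * d = ∑ h : H, (m h).trace) :
    IsIsogenous (image N) (⨁ fun _ : Fin d ↦ Y) := by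
  refine isIsogenous_iff_forall_finrank_hom_eq'.2 fun B ↦ ?_
  rw [finrank_hom_image_norm_eq_of_card_mul_eq B b m ρ hb hρ₁ hN hd, finrank_hom_biproduct_const, Fintype.card_fin]

/-- **`B_G(Y ⊗ M) ∼ Y^d` whenever `|G| · d = Σ_g tr m(g)`** (`d = rank M^G`; perfect field, `G` finite, `B_G = Im Σ_g ρ(g)`).
[cite: KaniRosen1989, §3 Thm. B] [cite: MazurRubinSilverberg2007, Thm. 2.1 (i), (iii) and Lemma 2.4] [cite: Milne1986AbelianVarieties, §12 p. 122] -/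
theorem isIsogenous_image_normG_biproduct [Fintype G] (hb : ∑ j, b.π j ≫ b.ι j = 𝟙 b.pt)
    (hρ₁ : ∀ (g : G) (i j : ι), b.ι j ≫ End.asHom (ρ g) ≫ b.π i = m g i j • 𝟙 Y)
    {NG : b.pt ⟶ b.pt} (hNG : End.of NG = ∑ g, ρ g) {d : ℕ} (hd : (Fintype.card G : ℤ) * d = ∑ g, (m g).trace) :
    IsIsogenous (image NG) (⨁ fun _ : Fin d ↦ Y) := by
  refine isIsogenous_iff_forall_finrank_hom_eq'.2 fun B ↦ ?_
  rw [finrank_hom_image_normG_eq_of_card_mul_eq B b m ρ hb hρ₁ hNG hd, finrank_hom_biproduct_const, Fintype.card_fin]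

variable [Fintype G] {c : ratCharIdempotents G → G → ℤ}
  (hc : ∀ e : ratCharIdempotents G,
    (Fintype.card G : ℚ) • (e : MonoidAlgebra ℚ G) = ∑ g, (c e g : ℚ) • MonoidAlgebra.of ℚ G g)
  {u : ratCharIdempotents G → (b.pt ⟶ b.pt)} (hu : ∀ e, End.of (u e) = ∑ g, c e g • ρ g)

include hc hu

/-- **`B_W(Y ⊗ M) ∼ Y^{d_W} = ⨁_{Fin d_W} Y` whenever `|G| · d_W = Σ_g c_W(g) tr m(g)`** (`d_W = dim_ℚ e_W M_ℚ`; perfect field): the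
isotypical component of `Y ⊗ M` at `W` — the twist `Y ⊗ (M ∩ e_W M_ℚ)` — is a power of `Y` up to isogeny: equal `Hom`-counts into
every `B` (§2) and `isIsogenous_iff_forall_finrank_hom_eq'`. [cite: LangeRodriguez2022, §2.9.1 Thm. 2.9.1 and Prop. 2.9.3 (PDF pp. 43, 46)]
[cite: MazurRubinSilverberg2007, Def. 4.3, Thm. 4.5 and Thm. 2.1 (iii)] [cite: LangeRecillas2004, §1 Prop. 1.1] [cite: Milne1986AbelianVarieties, §12 p. 122] -/
theorem isIsogenous_isotypical_biproduct (hb : ∑ j, b.π j ≫ b.ι j = 𝟙 b.pt)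
    (hρ₁ : ∀ (g : G) (i j : ι), b.ι j ≫ End.asHom (ρ g) ≫ b.π i = m g i j • 𝟙 Y) (e : ratCharIdempotents G) {d : ℕ}
    (hd : (Fintype.card G : ℤ) * d = ∑ g, c e g * (m g).trace) :
    IsIsogenous (image (u e)) (⨁ fun _ : Fin d ↦ Y) := by
  refine isIsogenous_iff_forall_finrank_hom_eq'.2 fun B ↦ ?_
  rw [finrank_hom_isotypical_eq_of_card_mul_eq B b m ρ hc hu hb hρ₁ e hd, finrank_hom_biproduct_const, Fintype.card_fin]

/-- **THE ISOTYPICAL DECOMPOSITION OF `Y ⊗ M`: `Y ⊗ M ∼ ∏_{W ∈ Irr_ℚ(G)} Y^{d_W}`** with `|G| · d_W = Σ_g c_W(g) tr m(g)` (perfect field):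
`X ∼ ∏_W B_W(X)` (the tree's `isIsogenous_biproduct_isotypical`) and `B_W(Y ⊗ M) ∼ Y^{d_W}` — "`Res V ∼ ⊕_ρ V_ρ`", "`I ⊗ ℚ ≅ ⊕ J_i ⊗ ℚ ⇒
I ⊗ V ∼ ⊕ J_i ⊗ V`", with each `J_i ⊗ V ≅ V^{rank J_i}` where untwisted. [cite: MazurRubinSilverberg2007, Thm. 4.5, Cor. 2.5 and Thm. 2.1 (iii)]
[cite: LangeRodriguez2022, §2.9.1 Thm. 2.9.1 (b) and Prop. 2.9.3 (PDF pp. 43, 46)] [cite: SerreLinearRepresentations1977, §2.6 Thm. 8] -/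
theorem isIsogenous_biproduct_biproduct (hb : ∑ j, b.π j ≫ b.ι j = 𝟙 b.pt)
    (hρ₁ : ∀ (g : G) (i j : ι), b.ι j ≫ End.asHom (ρ g) ≫ b.π i = m g i j • 𝟙 Y) {d : ratCharIdempotents G → ℕ}
    (hd : ∀ e, (Fintype.card G : ℤ) * d e = ∑ g, c e g * (m g).trace) :
    IsIsogenous b.pt (⨁ fun e ↦ ⨁ fun _ : Fin (d e) ↦ Y) := by
  classical
  exact (isIsogenous_biproduct_isotypical ρ hc hu).trans
    (IsIsogenous.biproduct fun e ↦ isIsogenous_isotypical_biproduct b m ρ hc hu hb hρ₁ e (hd e))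

end Isogeny

end LatticeTensor

end AbelianVariety

end Literature.AlgebraicGeometry.Motives
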